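import Summits.NavierStokesRegularity.FluidComputer.AngularGalerkinLadderBasics
import Literature.Analysis.FluidPDE.ClassicalSolutionCalculus

/-!
# The angular Galerkin ladder: the generators are skew-adjoint, the Casimir and the band
# defects are symmetric on `L²`, and every band defect lands in the co-band (theorems only)

Cell `ns-blowup`, seat `ns-blowup-lean` (g11). LABEL: KERNEL typing hygiene for the vocabulary of
`FluidComputer/AngularGalerkinLadder.lean` (route `Theses/AngularGalerkinLadder.lean`). WHAT THIS
IS NOT: not Navier–Stokes evidence — integration-by-parts identities for smooth fields on `ℝ³`;
nothing is asserted about any rung dynamics, no profile is constructed, no crux is touched.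

## Content

§1 Supports: `J_a w`, `𝒞 w`, `∏(𝒞 − j(j+1)) w` vanish off `tsupport w`
(`tsupport_angGen/casimir/bandDefect_subset`, `hasCompactSupport_…`).

§2 **Skew-adjointness of the generators**: for smooth `v`, `w` with `w` compactly supported,
`∫⟪J_a v, w⟫ = −∫⟪v, J_a w⟫` (`integral_inner_angGen_eq_neg`) — the algebraic part `[e_a]_×` is
skew, and the transport part `((e_a × x)·∇)` is skew by the tree's trilinear identity
`integral_inner_convect_add_eq_zero` since the rotation field `x ↦ e_a × x` is divergence free.

§3 **Symmetry and positivity of the Casimir**: `∫⟪𝒞v, w⟫ = Σ_a ∫⟪J_a v, J_a w⟫ = ∫⟪v, 𝒞w⟫`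
(`integral_inner_casimir_eq_sum`, `integral_inner_casimir_comm`), `∫⟪𝒞w, w⟫ = Σ_a ∫‖J_a w‖² ≥ 0`;
hence **a compactly supported field band-limited to degree `0` is rotation invariant**
(`angGen_eq_zero_of_isBandLimited_zero`: `𝒞w = 0 ⇒ J_a w = 0`).

§4 **Symmetry of the band defects and the range statement**: `𝒞` commutes with every
`∏(𝒞 − j(j+1))` (`casimir_bandDefect_comm`), `∫⟪∏(𝒞 − j(j+1)) v, w⟫ = ∫⟪v, ∏(𝒞 − j(j+1)) w⟫`
(`integral_inner_bandDefect_comm`), and therefore **`isCobandLimited_bandDefect`: for EVERY smooth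
field `v`, `∏_{j ≤ L}(𝒞 − j(j+1)) v` is co-band-limited of degree `L`** — the defect operator of the
vocabulary maps smooth fields into the co-band, the dual of `IsBandLimited L = ker`: the typed,
projection-free shadow of `ran (1 − Π_L) ⟂ ran Π_L`.

References: [cite: BullardGellman1954] (vector spherical harmonics; orthogonality of isotypes);
[cite: Leray1934, §6 (1.11) p. 203] (the trilinear integration-by-parts identity).
-/

noncomputable section

namespace Summit.NavierStokesRegularity.FluidComputer

open Set MeasureTheory Filter Topology Function
open scoped ContDiff RealInnerProductSpace
open Literature.Analysis.FluidPDE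

namespace AngularLadder

variable {v w : EuclideanSpace ℝ (Fin 3) → EuclideanSpace ℝ (Fin 3)} {L : ℕ}
  {x : EuclideanSpace ℝ (Fin 3)}

/-! ## §1 Supports -/

/-- `J_a w` vanishes off the topological support of `w` (no regularity needed: off `tsupport w`
both `w` and `Dw` vanish). [folklore] -/
theorem angGen_eq_zero_of_notMem_tsupport (a : Fin 3) (hx : x ∉ tsupport w) : angGen a w x = 0 := by
  rw [angGen_eq]
  simp only [image_eq_zero_of_notMem_tsupport hx, fderiv_of_notMem_tsupport ℝ hx, map_zero,
    _root_.zero_apply, sub_zero]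

/-- `tsupport (J_a w) ⊆ tsupport w`. [folklore] -/
theorem tsupport_angGen_subset (a : Fin 3) (w : EuclideanSpace ℝ (Fin 3) → EuclideanSpace ℝ (Fin 3)) :
    tsupport (angGen a w) ⊆ tsupport w :=
  closure_minimal (fun x hx => by
    by_contra h
    exact hx (angGen_eq_zero_of_notMem_tsupport a h)) (isClosed_tsupport w)

/-- `𝒞 w` vanishes off the topological support of `w`. [folklore] -/
theorem casimir_eq_zero_of_notMem_tsupport (hx : x ∉ tsupport w) : casimir w x = 0 := by
  have h : ∀ a : Fin 3, angGen a (angGen a w) x = 0 := fun a =>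
    angGen_eq_zero_of_notMem_tsupport a fun h => hx (tsupport_angGen_subset a w h)
  simp only [casimir, h, Finset.sum_const_zero, neg_zero]

/-- `tsupport (𝒞 w) ⊆ tsupport w`. [folklore] -/
theorem tsupport_casimir_subset (w : EuclideanSpace ℝ (Fin 3) → EuclideanSpace ℝ (Fin 3)) :
    tsupport (casimir w) ⊆ tsupport w :=
  closure_minimal (fun x hx => by
    by_contra h
    exact hx (casimir_eq_zero_of_notMem_tsupport h)) (isClosed_tsupport w)

/-- Every band defect of `w` vanishes off the topological support of `w`. [folklore] -/
theorem bandDefect_eq_zero_of_notMem_tsupport (L : ℕ) :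
    ∀ {w : EuclideanSpace ℝ (Fin 3) → EuclideanSpace ℝ (Fin 3)} {x : EuclideanSpace ℝ (Fin 3)},
      x ∉ tsupport w → bandDefect L w x = 0 := by
  induction L with
  | zero => intro w x hx; exact casimir_eq_zero_of_notMem_tsupport hx
  | succ L ih =>
      intro w x hx
      have hsub : tsupport (bandDefect L w) ⊆ tsupport w :=
        closure_minimal (fun y hy => by
          by_contra h
          exact hy (ih h)) (isClosed_tsupport w)
      change casimir (bandDefect L w) x - (((L : ℝ) + 1) * ((L : ℝ) + 2)) • bandDefect L w x = 0
      rw [ih hx, casimir_eq_zero_of_notMem_tsupport fun h => hx (hsub h), smul_zero, sub_zero]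

/-- `tsupport (∏(𝒞 − j(j+1)) w) ⊆ tsupport w`. [folklore] -/
theorem tsupport_bandDefect_subset (L : ℕ) (w : EuclideanSpace ℝ (Fin 3) → EuclideanSpace ℝ (Fin 3)) :
    tsupport (bandDefect L w) ⊆ tsupport w :=
  closure_minimal (fun x hx => by
    by_contra h
    exact hx (bandDefect_eq_zero_of_notMem_tsupport L h)) (isClosed_tsupport w)

/-- `J_a` preserves compact support. [folklore] -/
theorem hasCompactSupport_angGen (hwc : HasCompactSupport w) (a : Fin 3) :
    HasCompactSupport (angGen a w) :=
  hwc.mono' fun x hx => by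
    by_contra h
    exact hx (angGen_eq_zero_of_notMem_tsupport a h)

/-- `𝒞` preserves compact support. [folklore] -/
theorem hasCompactSupport_casimir (hwc : HasCompactSupport w) : HasCompactSupport (casimir w) :=
  hwc.mono' fun x hx => by
    by_contra h
    exact hx (casimir_eq_zero_of_notMem_tsupport h)

/-- Every band defect preserves compact support. [folklore] -/
theorem hasCompactSupport_bandDefect (hwc : HasCompactSupport w) (L : ℕ) :
    HasCompactSupport (bandDefect L w) :=
  hwc.mono' fun x hx => by
    by_contra h
    exact hx (bandDefect_eq_zero_of_notMem_tsupport L h)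

/-! ## §2 Skew-adjointness of the generators -/

/-- The cross product with a fixed vector is skew-adjoint: `⟪c × y, z⟫ = −⟪y, c × z⟫`.
Private twin of the tree's `inner_cross_left_eq_neg`. [folklore] -/
private theorem inner_crossCLM_left_eq_neg'' (c y z : EuclideanSpace ℝ (Fin 3)) :
    ⟪crossCLM c y, z⟫ = -⟪y, crossCLM c z⟫ := by
  simp only [crossCLM_apply, cross, PiLp.inner_apply, RCLike.inner_apply, conj_trivial,
    Fin.sum_univ_three, cross_apply, Matrix.cons_val_zero, Matrix.cons_val_one,
    Matrix.cons_val_two, Matrix.head_cons, Matrix.tail_cons]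
  ring

/-- `⟪y, c × y⟫ = 0`. [folklore] -/
private theorem inner_self_crossCLM (c y : EuclideanSpace ℝ (Fin 3)) : ⟪y, crossCLM c y⟫ = 0 := by
  simp only [crossCLM_apply, cross, PiLp.inner_apply, RCLike.inner_apply, conj_trivial,
    Fin.sum_univ_three, cross_apply, Matrix.cons_val_zero, Matrix.cons_val_one,
    Matrix.cons_val_two, Matrix.head_cons, Matrix.tail_cons]
  ring

/-- The rotation field `x ↦ c × x` is divergence free (its derivative `[c]_×` is skew, hence
traceless). [folklore] -/
theorem divergence_crossCLM (c x : EuclideanSpace ℝ (Fin 3)) :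
    VectorCalculus.divergence (fun y => crossCLM c y) x = 0 := by
  rw [divergence_eq_sum_inner_fderiv (EuclideanSpace.basisFun (Fin 3) ℝ),
    show (fun y => crossCLM c y) = ⇑(crossCLM c) from rfl, (crossCLM c).fderiv]
  simp only [inner_self_crossCLM, Finset.sum_const_zero]

/-- **Skew-adjointness of the rotation generators on `L²`**: for smooth `v`, `w` with `w`
compactly supported, `∫⟪J_a v, w⟫ = −∫⟪v, J_a w⟫`. The algebraic part `[e_a]_×` is pointwise
skew; the transport part is skew by the trilinear identity
`∫⟪(u·∇)v, w⟫ + ∫⟪v, (u·∇)w⟫ + ∫ div u ⟪v, w⟫ = 0` with the divergence-free field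
`u(x) = e_a × x`. [cite: Leray1934, §6 (1.11) p. 203] -/
theorem integral_inner_angGen_eq_neg (hv : ContDiff ℝ ∞ v) (hw : ContDiff ℝ ∞ w)
    (hwc : HasCompactSupport w) (a : Fin 3) :
    ∫ x, ⟪angGen a v x, w x⟫ = -∫ x, ⟪v x, angGen a w x⟫ := by
  have hv1 : ContDiff ℝ 1 v := contDiff_infty.1 hv 1
  have hw1 : ContDiff ℝ 1 w := contDiff_infty.1 hw 1
  have hC1 : ContDiff ℝ 1 fun y : EuclideanSpace ℝ (Fin 3) => crossCLM (axis a) y :=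
    (crossCLM (axis a)).contDiff
  -- the transport part: trilinear identity with the divergence-free field `y ↦ e_a × y`
  have htri := integral_inner_convect_add_eq_zero (u := fun y => crossCLM (axis a) y) hC1 hv1 hw1 hwc
  simp only [divergence_crossCLM, zero_mul, integral_zero, add_zero] at htri
  -- integrability of the four pairings
  have hvc : Continuous v := hv.continuous
  have hwc' : Continuous w := hw.continuous
  have hXv : Continuous fun y => convect (fun z => crossCLM (axis a) z) v y :=
    (hv.continuous_fderiv (by simp)).clm_apply (crossCLM (axis a)).continuous
  have hXw : Continuous fun y => convect (fun z => crossCLM (axis a) z) w y :=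
    (hw.continuous_fderiv (by simp)).clm_apply (crossCLM (axis a)).continuous
  have hXwc : HasCompactSupport fun y => convect (fun z => crossCLM (axis a) z) w y :=
    (hwc.fderiv (𝕜 := ℝ)).mono fun y hy => by
      contrapose! hy
      simp only [Function.mem_support, ne_eq, not_not] at hy ⊢
      simp [convect, hy]
  have hCwc : HasCompactSupport fun y => crossCLM (axis a) (w y) :=
    hwc.mono fun y hy => by
      contrapose! hy
      simp only [Function.mem_support, ne_eq, not_not] at hy ⊢
      rw [hy, map_zero]
  have i1 : Integrable fun y => ⟪v y, crossCLM (axis a) (w y)⟫ :=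
    integrable_inner_of_hasCompactSupport_right hvc ((crossCLM (axis a)).continuous.comp hwc') hCwc
  have i2 : Integrable fun y => ⟪convect (fun z => crossCLM (axis a) z) v y, w y⟫ :=
    integrable_inner_of_hasCompactSupport_right hXv hwc' hwc
  have i3 : Integrable fun y => ⟪v y, convect (fun z => crossCLM (axis a) z) w y⟫ :=
    integrable_inner_of_hasCompactSupport_right hvc hXw hXwc
  -- pointwise expansions of both integrands
  have e1 : (fun y => ⟪angGen a v y, w y⟫) = fun y =>
      -⟪v y, crossCLM (axis a) (w y)⟫ - ⟪convect (fun z => crossCLM (axis a) z) v y, w y⟫ := by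
    funext y
    rw [angGen_eq, inner_sub_left, inner_crossCLM_left_eq_neg'', convect_apply]
  have e2 : (fun y => ⟪v y, angGen a w y⟫) = fun y =>
      ⟪v y, crossCLM (axis a) (w y)⟫ - ⟪v y, convect (fun z => crossCLM (axis a) z) w y⟫ := by
    funext y
    rw [angGen_eq, inner_sub_right, convect_apply]
  have i1n : Integrable fun y => -⟪v y, crossCLM (axis a) (w y)⟫ := i1.neg
  rw [e1, e2, integral_sub i1n i2, integral_neg, integral_sub i1 i3]
  linarith

/-! ## §3 Symmetry and positivity of the Casimir -/

/-- **The Casimir as a Dirichlet form**: `∫⟪𝒞v, w⟫ = Σ_a ∫⟪J_a v, J_a w⟫` for smooth `v`, `w`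
with `w` compactly supported. [folklore] -/
theorem integral_inner_casimir_eq_sum (hv : ContDiff ℝ ∞ v) (hw : ContDiff ℝ ∞ w)
    (hwc : HasCompactSupport w) :
    ∫ x, ⟪casimir v x, w x⟫ = ∑ a : Fin 3, ∫ x, ⟪angGen a v x, angGen a w x⟫ := by
  have hJv : ∀ a : Fin 3, ContDiff ℝ ∞ (angGen a v) := contDiff_angGen hv
  have hJJv : ∀ a : Fin 3, ContDiff ℝ ∞ (angGen a (angGen a v)) := fun a =>
    contDiff_angGen (hJv a) a
  have hi : ∀ a : Fin 3, Integrable fun y => ⟪angGen a (angGen a v) y, w y⟫ := fun a =>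
    integrable_inner_of_hasCompactSupport_right (hJJv a).continuous hw.continuous hwc
  have e1 : (fun y => ⟪casimir v y, w y⟫) = fun y => -∑ a : Fin 3, ⟪angGen a (angGen a v) y, w y⟫ := by
    funext y
    simp only [casimir, inner_neg_left, sum_inner]
  rw [e1, integral_neg, integral_finsetSum _ fun a _ => hi a, ← Finset.sum_neg_distrib]
  refine Finset.sum_congr rfl fun a _ => ?_
  rw [integral_inner_angGen_eq_neg (hJv a) hw hwc a, neg_neg]

/-- The same Dirichlet form from the right: `∫⟪v, 𝒞w⟫ = Σ_a ∫⟪J_a v, J_a w⟫`. [folklore] -/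
theorem integral_inner_casimir_eq_sum' (hv : ContDiff ℝ ∞ v) (hw : ContDiff ℝ ∞ w)
    (hwc : HasCompactSupport w) :
    ∫ x, ⟪v x, casimir w x⟫ = ∑ a : Fin 3, ∫ x, ⟪angGen a v x, angGen a w x⟫ := by
  have hJw : ∀ a : Fin 3, ContDiff ℝ ∞ (angGen a w) := contDiff_angGen hw
  have hJJw : ∀ a : Fin 3, ContDiff ℝ ∞ (angGen a (angGen a w)) := fun a =>
    contDiff_angGen (hJw a) a
  have hJwc : ∀ a : Fin 3, HasCompactSupport (angGen a w) := hasCompactSupport_angGen hwc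
  have hi : ∀ a : Fin 3, Integrable fun y => ⟪v y, angGen a (angGen a w) y⟫ := fun a =>
    integrable_inner_of_hasCompactSupport_right hv.continuous (hJJw a).continuous
      (hasCompactSupport_angGen (hJwc a) a)
  have e1 : (fun y => ⟪v y, casimir w y⟫) = fun y => -∑ a : Fin 3, ⟪v y, angGen a (angGen a w) y⟫ := by
    funext y
    simp only [casimir, inner_neg_right, inner_sum]
  rw [e1, integral_neg, integral_finsetSum _ fun a _ => hi a, ← Finset.sum_neg_distrib]
  refine Finset.sum_congr rfl fun a _ => ?_
  rw [← integral_inner_angGen_eq_neg hv (hJw a) (hJwc a) a]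

/-- **Symmetry of the Casimir on `L²`**: `∫⟪𝒞v, w⟫ = ∫⟪v, 𝒞w⟫` for smooth `v`, `w` with `w`
compactly supported. [cite: BullardGellman1954] -/
theorem integral_inner_casimir_comm (hv : ContDiff ℝ ∞ v) (hw : ContDiff ℝ ∞ w)
    (hwc : HasCompactSupport w) :
    ∫ x, ⟪casimir v x, w x⟫ = ∫ x, ⟪v x, casimir w x⟫ := by
  rw [integral_inner_casimir_eq_sum hv hw hwc, integral_inner_casimir_eq_sum' hv hw hwc]

/-- **Positivity of the Casimir**: `∫⟪𝒞w, w⟫ = Σ_a ∫‖J_a w‖²` for smooth compactly supported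
`w`. [folklore] -/
theorem integral_inner_casimir_self (hw : ContDiff ℝ ∞ w) (hwc : HasCompactSupport w) :
    ∫ x, ⟪casimir w x, w x⟫ = ∑ a : Fin 3, ∫ x, ‖angGen a w x‖ ^ 2 := by
  rw [integral_inner_casimir_eq_sum hw hw hwc]
  simp only [real_inner_self_eq_norm_sq]

/-- `∫⟪𝒞w, w⟫ ≥ 0` for smooth compactly supported `w`. [folklore] -/
theorem integral_inner_casimir_self_nonneg (hw : ContDiff ℝ ∞ w) (hwc : HasCompactSupport w) :
    0 ≤ ∫ x, ⟪casimir w x, w x⟫ := by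
  rw [integral_inner_casimir_self hw hwc]
  exact Finset.sum_nonneg fun a _ => integral_nonneg fun y => sq_nonneg _

/-- **Compactly supported fields band-limited to degree `0` are rotation invariant**:
`𝒞w = 0` pointwise forces `J_a w = 0` for every `a` (each `∫‖J_a w‖² = 0` with a continuous
integrand). [cite: BullardGellman1954] -/
theorem angGen_eq_zero_of_isBandLimited_zero (h0 : IsBandLimited 0 w) (hwc : HasCompactSupport w)
    (a : Fin 3) : angGen a w = 0 := by
  have hz : ∫ x, ⟪casimir w x, w x⟫ = 0 := by
    have h : ∀ x, casimir w x = 0 := h0.2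
    simp only [h, inner_zero_left, integral_zero]
  rw [integral_inner_casimir_self h0.1 hwc] at hz
  have hnn : ∀ b ∈ (Finset.univ : Finset (Fin 3)), 0 ≤ ∫ x, ‖angGen b w x‖ ^ 2 :=
    fun b _ => integral_nonneg fun y => sq_nonneg _
  have ha := (Finset.sum_eq_zero_iff_of_nonneg hnn).1 hz a (Finset.mem_univ a)
  have hJc : Continuous (angGen a w) := (contDiff_angGen h0.1 a).continuous
  have hFc : Continuous fun y => ‖angGen a w y‖ ^ 2 := hJc.norm.pow 2
  have hFs : HasCompactSupport fun y => ‖angGen a w y‖ ^ 2 :=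
    (hasCompactSupport_angGen hwc a).norm.comp_left (g := fun r : ℝ => r ^ 2) (by simp)
  have hFi : Integrable fun y => ‖angGen a w y‖ ^ 2 := hFc.integrable_of_hasCompactSupport hFs
  have hae := (integral_eq_zero_iff_of_nonneg (fun y => sq_nonneg _) hFi).1 ha
  have heq : (fun y => ‖angGen a w y‖ ^ 2) = 0 := (hFc.ae_eq_iff_eq volume continuous_const).1 hae
  funext y
  have hy := congrFun heq y
  simp only [Pi.zero_apply, ne_eq, OfNat.ofNat_ne_zero, not_false_eq_true, pow_eq_zero_iff,
    norm_eq_zero] at hy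
  rw [hy, Pi.zero_apply]

/-! ## §4 Symmetry of the band defects; every band defect lands in the co-band -/

/-- The Casimir of a difference of smooth fields. [folklore] -/
private theorem casimir_sub (hv : ContDiff ℝ ∞ v) (hw : ContDiff ℝ ∞ w) :
    casimir (v - w) = casimir v - casimir w := by
  have hwn : ContDiff ℝ ∞ ((-1 : ℝ) • w) := hw.const_smul (-1 : ℝ)
  have e : v - w = v + (-1 : ℝ) • w := by rw [neg_one_smul, sub_eq_add_neg]
  rw [e, casimir_add hv hwn, casimir_smul hw (-1), neg_one_smul, sub_eq_add_neg]

/-- **The Casimir commutes with every band defect** (both are polynomials in `𝒞`). [folklore] -/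
theorem casimir_bandDefect_comm (hw : ContDiff ℝ ∞ w) (L : ℕ) :
    casimir (bandDefect L w) = bandDefect L (casimir w) := by
  induction L with
  | zero => rfl
  | succ L ih =>
      have hB : ContDiff ℝ ∞ (bandDefect L w) := contDiff_bandDefect hw L
      have e1 : bandDefect (L + 1) w =
          casimir (bandDefect L w) - (((L : ℝ) + 1) * ((L : ℝ) + 2)) • bandDefect L w :=
        funext fun y => rfl
      have e2 : bandDefect (L + 1) (casimir w) = casimir (bandDefect L (casimir w)) -
          (((L : ℝ) + 1) * ((L : ℝ) + 2)) • bandDefect L (casimir w) :=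
        funext fun y => rfl
      have hS : ContDiff ℝ ∞ ((((L : ℝ) + 1) * ((L : ℝ) + 2)) • bandDefect L w) :=
        hB.const_smul (((L : ℝ) + 1) * ((L : ℝ) + 2))
      rw [e1, e2, casimir_sub (contDiff_casimir hB) hS, casimir_smul hB, ih]

/-- **Symmetry of the band defects on `L²`**: `∫⟪∏(𝒞 − j(j+1)) v, w⟫ = ∫⟪v, ∏(𝒞 − j(j+1)) w⟫`
for smooth `v`, `w` with `w` compactly supported. [cite: BullardGellman1954] -/
theorem integral_inner_bandDefect_comm (hv : ContDiff ℝ ∞ v) (L : ℕ) :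
    ∀ {w : EuclideanSpace ℝ (Fin 3) → EuclideanSpace ℝ (Fin 3)}, ContDiff ℝ ∞ w →
      HasCompactSupport w → ∫ x, ⟪bandDefect L v x, w x⟫ = ∫ x, ⟪v x, bandDefect L w x⟫ := by
  induction L with
  | zero => intro w hw hwc; exact integral_inner_casimir_comm hv hw hwc
  | succ L ih =>
      intro w hw hwc
      have hB : ContDiff ℝ ∞ (bandDefect L v) := contDiff_bandDefect hv L
      have hCB : ContDiff ℝ ∞ (casimir (bandDefect L v)) := contDiff_casimir hB
      have hBw : ContDiff ℝ ∞ (bandDefect L w) := contDiff_bandDefect hw L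
      have hCw : ContDiff ℝ ∞ (casimir w) := contDiff_casimir hw
      have hCwc : HasCompactSupport (casimir w) := hasCompactSupport_casimir hwc
      have hBwc : HasCompactSupport (bandDefect L w) := hasCompactSupport_bandDefect hwc L
      have i1 : Integrable fun y => ⟪casimir (bandDefect L v) y, w y⟫ :=
        integrable_inner_of_hasCompactSupport_right hCB.continuous hw.continuous hwc
      have i2 : Integrable fun y => ⟪bandDefect L v y, w y⟫ :=
        integrable_inner_of_hasCompactSupport_right hB.continuous hw.continuous hwc
      have i3 : Integrable fun y => ⟪v y, casimir (bandDefect L w) y⟫ :=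
        integrable_inner_of_hasCompactSupport_right hv.continuous (contDiff_casimir hBw).continuous
          (hasCompactSupport_casimir hBwc)
      have i4 : Integrable fun y => ⟪v y, bandDefect L w y⟫ :=
        integrable_inner_of_hasCompactSupport_right hv.continuous hBw.continuous hBwc
      have e1 : (fun y => ⟪bandDefect (L + 1) v y, w y⟫) = fun y =>
          ⟪casimir (bandDefect L v) y, w y⟫ -
            (((L : ℝ) + 1) * ((L : ℝ) + 2)) * ⟪bandDefect L v y, w y⟫ := by
        funext y
        change ⟪casimir (bandDefect L v) y - (((L : ℝ) + 1) * ((L : ℝ) + 2)) • bandDefect L v y,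
          w y⟫ = _
        rw [inner_sub_left, inner_smul_left]
        rfl
      have e2 : (fun y => ⟪v y, bandDefect (L + 1) w y⟫) = fun y =>
          ⟪v y, casimir (bandDefect L w) y⟫ -
            (((L : ℝ) + 1) * ((L : ℝ) + 2)) * ⟪v y, bandDefect L w y⟫ := by
        funext y
        change ⟪v y, casimir (bandDefect L w) y -
          (((L : ℝ) + 1) * ((L : ℝ) + 2)) • bandDefect L w y⟫ = _
        rw [inner_sub_right, inner_smul_right]
      rw [e1, e2, integral_sub i1 (i2.const_mul _), integral_sub i3 (i4.const_mul _),
        integral_const_mul, integral_const_mul, integral_inner_casimir_comm hB hw hwc,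
        ih hCw hCwc, ih hw hwc, casimir_bandDefect_comm hw L]

/-- **Every band defect lands in the co-band**: for every smooth field `v`,
`∏_{j ≤ L}(𝒞 − j(j+1)) v` is co-band-limited of degree `L` — it is `L²`-orthogonal to every
compactly supported band-limited field `ψ`, since `∫⟪∏(…)v, ψ⟫ = ∫⟪v, ∏(…)ψ⟫ = ∫⟪v, 0⟫`. The
defect operator of the vocabulary maps into the co-band, dual to `IsBandLimited L = ker ∏(…)`.
[cite: BullardGellman1954] -/
theorem isCobandLimited_bandDefect (hv : ContDiff ℝ ∞ v) (L : ℕ) :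
    IsCobandLimited L (bandDefect L v) := by
  intro ψ hψ hψc
  rw [integral_inner_bandDefect_comm hv L hψ.1 hψc]
  have h0 : ∀ x, bandDefect L ψ x = 0 := hψ.2
  simp only [h0, inner_zero_right, integral_zero]

/-- The Casimir of a smooth field is co-band-limited of degree `0` (the case `L = 0`).
[folklore] -/
theorem isCobandLimited_zero_casimir (hv : ContDiff ℝ ∞ v) : IsCobandLimited 0 (casimir v) :=
  isCobandLimited_bandDefect hv 0

end AngularLadder

end Summit.NavierStokesRegularity.FluidComputer

end
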